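import Literature.IUT.HodgeTheaters.InitialThetaDataThm19Functorial
import Literature.IUT.HodgeTheaters.InitialThetaDataLocalCurves
import Literature.IUT.HodgeTheaters.InitialThetaDataCurveModelLocalLaws
import Literature.IUT.HodgeTheaters.InitialThetaDataLocalGaloisProofs
import Literature.AnabelianGeometry.AbsoluteAnabelian.MLFAbsoluteGaloisGroupInfinite
import HarnessLib

/-!
# [IUTchI] Ex. 5.4 (iv) / X-143 (v-loc): the recorded Galois action at `C_F` AND at every local `C_v`

S. Mochizuki, *Inter-universal Teichmüller Theory I*, [IUTchI] Ex. 5.1 (i) p. 123, Ex. 5.4 (iv) p. 149 (kurims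
May-2020 manuscript, lit key `paper:url-690e7b3c6199`); [AbsTopIII] Thm. 1.9 pp. 37–38 (the functoriality clause).

Cell `abc-iut`, seat abc-iut-c312-2 (L4 lineage / ERRATA-L5 X-143 owner, RULINGS #352).  Design memo of record
`pub/ideators/abc-iut-inv-2/X143-CURE-DESIGN.md` v0.3 §(iv) «(v-loc), OPTIONAL»: abc-iut-c312-2 gen 13's
`InitialThetaData.nfGaloisAction G` (★ `InitialThetaDataThm19Functorial.lean`) records the coefficient action at ONE
curve, `C_F`; the binder of record downstream is `D.Thm19' G := Thm_1_9' (D.nfCurveModelLocal G) (D.nfGaloisAction G)`.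
THIS FILE extends the DATUM (never the binder's admissibility) to the local `C`-curves of the enriched model:

* `InitialThetaData.nfGaloisActionLoc G` — recorded curves `Option (HeightOneSpectrum (𝓞 K))`: `none ↦ C_F` with
  v0.1's coefficient action through `augGF` (ON THE NOSE `D.nfGaloisAction G`), `some v ↦ C_v` (`D.locCurve G (.C v)`,
  `K_{Z_NF}(C_v) = RatFunc F̄` by `rfl`) with `g ∈ Π_{C_v}` acting through its image under the decomposition map
  `Π_{C_v} → Π_{C_K} ⊆ Π_{C_F}` (`D.decompHomC v`) and the coefficient action of `augGF`;
* `InitialThetaData.Thm19Loc' G := Thm_1_9' (D.nfCurveModelLocal G) (D.nfGaloisActionLoc G)` — the OPTIONAL wider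
  binder; `Thm19Loc'.toThm19'` (projection to the binder of record: NOTHING downstream changes), `Thm19Loc'.toThm_1_9`;
* `isThm19Input_nfGaloisActionLoc` — every recorded curve IS a Thm-1.9 input (global: GB-07; local: GB-13's
  `isThm19Input_local`, `K_v` sub-`p`-adic), so the inner-equivariance clause is DEMANDED at every `C_v`;
* NEG at a local curve, generic form: `not_witnessedBy_thm19Loc'_of_isInnerTrivialAt_local` — an algorithm
  inner-trivial on `Π_{C_v} ↠ G_{K_v}` does not witness `Thm19Loc' G` as soon as the recorded local action moves an
  element (`hmove`, left as a hypothesis here: it unfolds to «some `σ ∈ G_{K_v}` acts non-trivially on `F̄` through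
  `G_{K_v} → G_K ≅ Gal(F̄/K)`», a statement about FILE 1's `localGalHom` not needed by anybody downstream);
  NEG at `C_F` transported: `not_witnessedBy_thm19Loc'_of_isInnerTrivialAt_global` (binder-free, via gen 13's
  `not_witnessedBy_thm19'_of_isInnerTrivialAt'`).

HONEST FRAMING: `Thm19Loc' G` is a HYPOTHESIS (a strengthened FACT typed by name, instance form ONLY — `∀ M ρ` is
refuted a fortiori by `not_forall_thm_1_9`); nothing of [AbsTopIII] is proved; no ★ file is edited; no `instance`, no
notation, no axiom, no `sorry`; no side is taken on [IUTchIII] Cor. 3.12; count-neutral; nothing here asserts that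
abc is proved or refuted.
-/

noncomputable section

universe u

namespace Literature.IUT.HodgeTheaters

open Literature.AnabelianGeometry.AbsoluteAnabelian
open Literature.AnabelianGeometry.AbsoluteAnabelian.AbsTopIII
open Literature.FieldTheory.FunctionField
open IsDedekindDomain NumberField

namespace InitialThetaData

variable {F K Fbar : Type u} [Field F] [NumberField F] [Field K] [NumberField K] [Algebra F K]
  [Field Fbar] [Algebra F Fbar] [Algebra K Fbar] {E : WeierstrassCurve F} [E.IsElliptic] {l : ℕ}
  {Pb : BadPlacePredicates K} (D : InitialThetaData F K Fbar E l Pb)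

/-- **The recorded action of the enriched model at `C_F` AND at every local `C_v`** (memo §(iv) (v-loc)): at
`none` the curve `C_F` with the coefficient action through `augGF` (= `D.nfGaloisAction G` on the nose); at `some v`
the local curve `C_v` (`K_{Z_NF}(C_v) = F̄(t)`), `g ∈ Π_{C_v}` acting on the coefficients through its image under the
decomposition map `Π_{C_v} → Π_{C_K} ⊆ Π_{C_F}` (`D.decompHomC v`) and `augGF`.
([IUTchI] Ex 5.4 (iv) p.149) [claim: Mochizuki2012, status: disputed] -/
def nfGaloisActionLoc (G : D.LocalThetaGeometry) : (D.nfCurveModelLocal G).NFGaloisAction where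
  ι := Option (HeightOneSpectrum (𝓞 K))
  curve i := match i with
    | none => D.globalCurve G .CF
    | some v => D.locCurve G (.C v)
  act i := match i with
    | none => fun g => ratFuncMapCoeffs (D.augGF g : Fbar →+* Fbar)
    | some v => fun g => ratFuncMapCoeffs (D.augGF ((D.decompHomC v).arith g).1 : Fbar →+* Fbar)

/-- `rfl` read-out: the recorded curve at `none` is `C_F`. ([IUTchI] Ex 5.1 (i) p.123) [claim: Mochizuki2012, status: disputed] -/
@[simp] theorem nfGaloisActionLoc_curve_none (G : D.LocalThetaGeometry) :
    (D.nfGaloisActionLoc G).curve none = D.globalCurve G .CF := rfl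

/-- `rfl` read-out: the recorded curve at `some v` is `C_v`. ([IUTchI] Ex 5.4 (iv) p.149) [claim: Mochizuki2012, status: disputed] -/
@[simp] theorem nfGaloisActionLoc_curve_some (G : D.LocalThetaGeometry) (v : HeightOneSpectrum (𝓞 K)) :
    (D.nfGaloisActionLoc G).curve (some v) = D.locCurve G (.C v) := rfl

/-- `rfl` read-out: at `none` the recorded action is v0.1's coefficient action.
([IUTchI] Ex 5.1 (i) p.123) [claim: Mochizuki2012, status: disputed] -/
theorem nfGaloisActionLoc_act_none (G : D.LocalThetaGeometry) (g : D.geom.extF.arith) :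
    (D.nfGaloisActionLoc G).act none g = (D.nfGaloisAction G).act PUnit.unit g := rfl

/-- `rfl` read-out: at `some v` the recorded action is the coefficient action through the decomposition map.
([IUTchI] Ex 5.4 (iv) p.149) [claim: Mochizuki2012, status: disputed] -/
theorem nfGaloisActionLoc_act_some (G : D.LocalThetaGeometry) (v : HeightOneSpectrum (𝓞 K))
    (g : (D.extLocC v).arith) :
    (D.nfGaloisActionLoc G).act (some v) g =
      ratFuncMapCoeffs (D.augGF ((D.decompHomC v).arith g).1 : Fbar →+* Fbar) := rfl

/-- Every recorded curve of `nfGaloisActionLoc` IS a Thm-1.9 input (so the inner-equivariance clause is demanded at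
every `C_v`, not only at `C_F`). ([IUTchI] Ex 5.4 (iv) p.149) [claim: Mochizuki2012, status: disputed] -/
theorem isThm19Input_nfGaloisActionLoc (G : D.LocalThetaGeometry) (i : (D.nfGaloisActionLoc G).ι) :
    (D.nfCurveModelLocal G).IsThm19Input ((D.nfGaloisActionLoc G).curve i) := by
  cases i with
  | none => exact D.isThm19Input_global G .CF
  | some v => exact G.isThm19Input_local (.C v)

/-- **The OPTIONAL wider binder (v-loc)**: `AbsTopIII.Thm_1_9'` at the pair (enriched model, recorded action at `C_F`
and at every `C_v`).  Instance form ONLY; a HYPOTHESIS asserted by nobody; the binder of record downstream remains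
`D.Thm19' G`. ([IUTchI] Ex 5.4 (iv) p.149) [claim: Mochizuki2012, status: disputed] -/
abbrev Thm19Loc' (G : D.LocalThetaGeometry) : Prop :=
  Thm_1_9' (D.nfCurveModelLocal G) (D.nfGaloisActionLoc G)

/-- `D.Thm19Loc' G → D.Thm19' G`: the wider datum projects onto the binder of record (same algorithm; the clause at
`none` IS the clause of `nfGaloisAction`).  NOTHING downstream changes. ([IUTchI] Ex 5.4 (iv) p.149)
[claim: Mochizuki2012, status: disputed] -/
theorem Thm19Loc'.toThm19' {G : D.LocalThetaGeometry} (h : D.Thm19Loc' G) : D.Thm19' G := by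
  obtain ⟨A, h1, h2⟩ := h
  exact ⟨A, h1, fun _ hi => h2 none hi⟩

/-- `D.Thm19Loc' G → Thm_1_9 (D.nfCurveModelLocal G)`. ([IUTchI] Ex 5.4 (iv) p.149) [claim: Mochizuki2012, status: disputed] -/
theorem Thm19Loc'.toThm_1_9 {G : D.LocalThetaGeometry} (h : D.Thm19Loc' G) : Thm_1_9 (D.nfCurveModelLocal G) :=
  Thm_1_9'.toThm_1_9 h

/-- **NEG at a local curve (generic form)**: an algorithm INNER-TRIVIAL on `Π_{C_v} ↠ G_{K_v}` does not witness
`Thm19Loc' G` as soon as the recorded local action moves an element of `F̄(t)` (`hmove`: some `σ ∈ G_{K_v}` acts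
non-trivially on `F̄` through `G_{K_v} → Gal(F̄/K)` — a property of FILE 1's `localGalHom`, left as a hypothesis).
([IUTchI] Ex 5.4 (iv) p.149) [claim: Mochizuki2012, status: disputed] -/
theorem not_witnessedBy_thm19Loc'_of_isInnerTrivialAt_local (G : D.LocalThetaGeometry) (v : HeightOneSpectrum (𝓞 K))
    {A : NFPortionAlgorithm.{u}} (hA : A.IsInnerTrivialAt (D.extLocC v))
    (hmove : ∃ (g : (D.extLocC v).arith) (f : RatFunc Fbar),
      ratFuncMapCoeffs (D.augGF ((D.decompHomC v).arith g).1 : Fbar →+* Fbar) f ≠ f) :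
    ¬ Thm_1_9'.WitnessedBy (D.nfCurveModelLocal G) (D.nfGaloisActionLoc G) A :=
  Thm_1_9'.not_witnessedBy_of_isInnerTrivialAt (ρ := D.nfGaloisActionLoc G) (some v)
    (D.isThm19Input_nfGaloisActionLoc G (some v)) hA hmove


/-- At `some v` the recorded action of `g ∈ Π_{C_v}` is the coefficient action of `localToGFAt v (aug g)`, the
element of `G_F` attached to the image of `g` in `G_{K_v}` (the pullback square of `D.extLocC v`).
([IUTchI] Def 3.1 (e) p.62) [claim: Mochizuki2012, status: disputed] -/
theorem augGF_decompHomC_arith (v : HeightOneSpectrum (𝓞 K)) (g : (D.extLocC v).arith) :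
    D.augGF ((D.decompHomC v).arith g).1 = D.localToGFAt v ((D.extLocC v).aug g) := by
  have h := congrArg Subtype.val
    ((D.geom.extF.ofOpenSubgroup D.openPiCK).aug_fst_eq (D.localGalHom _ D.map_augGF_PiCK v) g)
  rw [FundamentalExtension.ofOpenSubgroup_aug_apply_coe, coe_localGalHom_apply] at h
  change D.augGF g.1.1.1 = D.localToGFAt v g.1.2
  rw [augGF_apply, h]
  exact D.galFEquiv.apply_symm_apply _

/-- **The recorded LOCAL action moves something** (binder-free `hmove` at `C_v`): `G_{K_v}` is infinite (`K_v` is an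
MLF), `G_{K_v} → G_F` is injective (Krasner density, `localToGF_injective_adicCompletion`), so some `g ∈ Π_{C_v}` acts
non-trivially on the constants of `F̄(t)`. ([IUTchI] Def 3.1 (e) p.62) [claim: Mochizuki2012, status: disputed] -/
theorem nfGaloisActionLoc_exists_act_ne_local (v : HeightOneSpectrum (𝓞 K)) :
    ∃ (g : (D.extLocC v).arith) (f : RatFunc Fbar),
      ratFuncMapCoeffs (D.augGF ((D.decompHomC v).arith g).1 : Fbar →+* Fbar) f ≠ f := by
  haveI := D.normal_K
  haveI := D.isScalarTower
  haveI := D.isAlgClosure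
  haveI : IsAlgClosed Fbar := IsAlgClosure.isAlgClosed F
  haveI : Infinite (Field.absoluteGaloisGroup (v.adicCompletion K)) :=
    (isMLF_adicCompletion_univ (K := K) v).infinite_absoluteGaloisGroup
  obtain ⟨σ, hσ⟩ := exists_ne (1 : Field.absoluteGaloisGroup (v.adicCompletion K))
  have hinj : Function.Injective (D.localToGFAt v) :=
    (localToGF_injective_adicCompletion v (D.localEmbAt v) F).comp
      (Field.absoluteGaloisGroup.toAlgEquiv (v.adicCompletion K)).injective
  have hτ : D.localToGFAt v σ ≠ 1 := fun h => hσ (hinj (by rw [h, map_one]))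
  obtain ⟨c, hc⟩ : ∃ c : Fbar, D.localToGFAt v σ c ≠ c := by
    by_contra hall
    push Not at hall
    exact hτ (AlgEquiv.ext hall)
  obtain ⟨g, hg⟩ := (D.extLocC v).aug_surjective σ
  refine ⟨g, RatFunc.C c, ?_⟩
  rw [augGF_decompHomC_arith, hg, ratFuncMapCoeffs_C]
  exact fun h => hc (RatFunc.C_injective h)

/-- **NEG at a local curve, binder-free**: NO algorithm inner-trivial on `Π_{C_v} ↠ G_{K_v}` witnesses `Thm19Loc' G`.
([IUTchI] Ex 5.4 (iv) p.149) [claim: Mochizuki2012, status: disputed] -/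
theorem not_witnessedBy_thm19Loc'_of_isInnerTrivialAt_local' (G : D.LocalThetaGeometry)
    (v : HeightOneSpectrum (𝓞 K)) {A : NFPortionAlgorithm.{u}} (hA : A.IsInnerTrivialAt (D.extLocC v)) :
    ¬ Thm_1_9'.WitnessedBy (D.nfCurveModelLocal G) (D.nfGaloisActionLoc G) A :=
  D.not_witnessedBy_thm19Loc'_of_isInnerTrivialAt_local G v hA (D.nfGaloisActionLoc_exists_act_ne_local v)

/-- **NEG at `C_F`, binder-free** (gen 13's `not_witnessedBy_thm19'_of_isInnerTrivialAt'` transported along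
`Thm19Loc'.toThm19'`-style projection at the level of `WitnessedBy`): an algorithm inner-trivial on `Π_{C_F} ↠ G_F`
does not witness `Thm19Loc' G`. ([IUTchI] Ex 5.1 (i) p.123) [claim: Mochizuki2012, status: disputed] -/
theorem not_witnessedBy_thm19Loc'_of_isInnerTrivialAt_global (G : D.LocalThetaGeometry) {A : NFPortionAlgorithm.{u}}
    (hA : A.IsInnerTrivialAt D.geom.extF) :
    ¬ Thm_1_9'.WitnessedBy (D.nfCurveModelLocal G) (D.nfGaloisActionLoc G) A := fun h =>
  D.not_witnessedBy_thm19'_of_isInnerTrivialAt' G hA ⟨h.1, fun _ hi => h.2 none hi⟩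

end InitialThetaData

end Literature.IUT.HodgeTheaters

end
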